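import Mathlib.Topology.Algebra.Group.Quotient
import Mathlib.Topology.Algebra.Group.Compact
import Mathlib.Topology.Algebra.ClopenNhdofOne
import Mathlib.Topology.Algebra.OpenSubgroup
import Mathlib.Topology.LocallyConstant.Basic
import Mathlib.Order.Zorn
import HarnessLib

/-!
# The cross-section theorem for profinite groups (Shatz I §2 Thm. 3)

**Theorem** (Shatz, *Profinite groups, arithmetic, and geometry*, Ch. I §2, Thm. 3
"Cross-section Theorem"; Serre, *Cohomologie galoisienne*, I §1.2, Prop. 1). Let `G` be a
profinite group and `N` a closed normal subgroup. Then the projection `G → G/N` has a continuous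
cross-section `φ : G/N → G` (`π ∘ φ = id`; not a homomorphism in general):
`exists_continuous_section_of_isClosed`.

Proof (Shatz, loc. cit.): Zorn's lemma on pairs `⟨S, λ⟩` of a closed normal subgroup
`S ⊆ N` and a continuous section `λ : G/N → G/S`, ordered by refinement (chains have upper
bounds by compactness: `G/⋂ Sᵢ → lim G/Sᵢ` is a homeomorphism onto its image); a maximal pair
has `S = 1`, for otherwise there is an open normal subgroup `U ⊉ S`, and a section
`G/S → G/(S ∩ U)` exists because `G/(S ∩ U) → G/S` is injective on the compact image of `U`,
hence a homeomorphism onto the open subgroup `US/S`, and one translates to its finitely many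
cosets (`exists_section_of_inf_open`). Sections `G/N → G/S` are encoded by representatives
`f : G/N → G` with `G/N → G → G/S` continuous (`SectionDatum`), which avoids transporting maps
between the dependent types `G ⧸ S`.

## References

* S. S. Shatz, *Profinite groups, arithmetic, and geometry*, Ann. of Math. Studies 67 (1972),
  Ch. I §2 Thm. 3 and Corollary. [Shatz1972]
* J.-P. Serre, *Cohomologie galoisienne*, LNM 5 (1994), I §1.2 Prop. 1.
  [SerreGaloisCohomology1997]
-/

noncomputable section

open Topology
open scoped Pointwise

universe u

namespace Literature.NumberTheory.GaloisRepresentations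

namespace ProfiniteCrossSection

variable {G : Type u} [Group G] [TopologicalSpace G] [IsTopologicalGroup G]

/-! ### Quotient maps between quotients -/

/-- The projection `G ⧸ T → G ⧸ S` for `T ≤ S` (Mathlib `QuotientGroup.map` along the
identity). [folklore] -/
abbrev proj (T S : Subgroup G) [T.Normal] [S.Normal] (h : T ≤ S) : G ⧸ T →* G ⧸ S :=
  QuotientGroup.map T S (MonoidHom.id G) h

omit [TopologicalSpace G] [IsTopologicalGroup G] in
/-- `proj` on classes. [folklore] -/
@[simp] theorem proj_mk (T S : Subgroup G) [T.Normal] [S.Normal] (h : T ≤ S) (x : G) :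
    proj T S h (x : G ⧸ T) = (x : G ⧸ S) := rfl

omit [IsTopologicalGroup G] in
/-- `proj` is continuous (it is induced from the identity through the quotient map `G → G ⧸ T`).
[folklore] -/
theorem continuous_proj (T S : Subgroup G) [T.Normal] [S.Normal] (h : T ≤ S) :
    Continuous (proj T S h) := by
  rw [(QuotientGroup.isQuotientMap_mk T).continuous_iff]
  exact QuotientGroup.continuous_mk

omit [TopologicalSpace G] [IsTopologicalGroup G] in
/-- `proj` is surjective. [folklore] -/
theorem proj_surjective (T S : Subgroup G) [T.Normal] [S.Normal] (h : T ≤ S) :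
    Function.Surjective (proj T S h) := by
  rintro ⟨x⟩
  exact ⟨(x : G ⧸ T), rfl⟩

/-! ### Step 1: sections of `G ⧸ T → G ⧸ S` when `S ∩ U ≤ T` for an open subgroup `U` -/

section Step

variable [CompactSpace G]

/-- **Local-to-global step** (Shatz I §2, proof of Thm. 3, the case of a finite kernel): if
`T ≤ S` are closed normal subgroups of a compact group `G` and `U` is an open subgroup with
`U ∩ S ≤ T`, then `G ⧸ T → G ⧸ S` has a continuous section. Proof: the projection is injective
on the compact image `K` of `U` in `G ⧸ T`, hence a homeomorphism of `K` onto the open subgroup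
`W = US/S` of `G ⧸ S`; invert it on `W` and translate to the cosets of `W`.
[cite: Shatz1972, Ch. I §2 Thm. 3 (proof)] -/
theorem exists_section_of_inf_le (S T : Subgroup G) [S.Normal] [T.Normal]
    (hS : IsClosed (S : Set G)) (hTS : T ≤ S) (U : Subgroup G)
    (hU : IsOpen (U : Set G)) (hUS : U ⊓ S ≤ T) :
    ∃ σ : G ⧸ S → G ⧸ T, Continuous σ ∧ ∀ y, proj T S hTS (σ y) = y := by
  haveI : IsClosed (S : Set G) := hS
  let q : G ⧸ T →* G ⧸ S := proj T S hTS
  have hq : Continuous q := continuous_proj T S hTS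
  -- the compact image of `U` in `G ⧸ T`, on which `q` is injective
  let K : Set (G ⧸ T) := QuotientGroup.mk '' (U : Set G)
  have hKc : IsCompact K := ((U.isClosed_of_isOpen hU).isCompact).image QuotientGroup.continuous_mk
  have hinj : Set.InjOn q K := by
    rintro _ ⟨u, hu, rfl⟩ _ ⟨u', hu', rfl⟩ h
    change ((u : G) : G ⧸ S) = ((u' : G) : G ⧸ S) at h
    rw [QuotientGroup.eq] at h ⊢
    exact hUS ⟨U.mul_mem (U.inv_mem hu) hu', h⟩
  -- `q|_K : K ≃ₜ q '' K`
  let e₀ : K ≃ q '' K :=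
    Equiv.ofBijective (Set.imageFactorization q K)
      ⟨fun a b h => Subtype.ext (hinj a.2 b.2 (congrArg Subtype.val h)),
        fun ⟨_, k, hk, hy⟩ => ⟨⟨k, hk⟩, Subtype.ext hy⟩⟩
  haveI : CompactSpace K := isCompact_iff_compactSpace.mp hKc
  let e : K ≃ₜ q '' K := Continuous.homeoOfEquivCompactToT2 (f := e₀)
    (continuous_induced_rng.2 (hq.comp continuous_subtype_val))
  have he : ∀ k : K, ((e k : q '' K) : G ⧸ S) = q k := fun _ => rfl
  have he' : ∀ w : q '' K, q ((e.symm w : K) : G ⧸ T) = w := fun w => by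
    rw [← he, e.apply_symm_apply]
  -- `W = q '' K = US/S` is an open subgroup of `G ⧸ S`
  let W : Subgroup (G ⧸ S) := U.map (QuotientGroup.mk' S)
  have hWK : (W : Set (G ⧸ S)) = q '' K := by
    ext y
    simp only [W, K, Subgroup.coe_map, QuotientGroup.coe_mk', Set.mem_image, SetLike.mem_coe,
      exists_exists_and_eq_and]
    rfl
  have hWo : IsOpen (W : Set (G ⧸ S)) := by
    change IsOpen (QuotientGroup.mk '' (U : Set G))
    exact QuotientGroup.isOpenMap_coe _ hU
  -- the local section on `W`, extended by `1`
  classical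
  let σ₀ : G ⧸ S → G ⧸ T := fun z =>
    if hz : z ∈ q '' K then ((e.symm ⟨z, hz⟩ : K) : G ⧸ T) else 1
  have hσ₀q : ∀ z ∈ q '' K, q (σ₀ z) = z := fun z hz => by
    simp only [σ₀, hz, dite_true]
    exact he' ⟨z, hz⟩
  have hσ₀c : ContinuousOn σ₀ (q '' K) := by
    rw [continuousOn_iff_continuous_restrict]
    have : (q '' K).restrict σ₀ = fun w => ((e.symm w : K) : G ⧸ T) := by
      funext w
      simp only [Set.restrict_apply, σ₀, w.2, dite_true]
    rw [this]
    exact continuous_subtype_val.comp e.symm.continuous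
  -- coset representatives modulo `W`, a locally constant choice
  let r : G ⧸ S → G ⧸ S := fun y => Quotient.out (QuotientGroup.mk (s := W) y)
  have hr : ∀ y, (r y)⁻¹ * y ∈ W := fun y => by
    rw [← QuotientGroup.eq]
    exact QuotientGroup.out_eq' _
  have hrW : ∀ y, (r y)⁻¹ * y ∈ q '' K := fun y => by rw [← hWK]; exact hr y
  have hrc : Continuous r := by
    haveI : DiscreteTopology ((G ⧸ S) ⧸ W) := QuotientGroup.discreteTopology hWo
    exact (continuous_of_discreteTopology (f := (Quotient.out : (G ⧸ S) ⧸ W → G ⧸ S))).comp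
      (QuotientGroup.continuous_mk (N := W))
  -- a set-theoretic lift `G ⧸ S → G ⧸ T`
  let lift : G ⧸ S → G ⧸ T := Function.surjInv (proj_surjective T S hTS)
  have hlift : ∀ z, q (lift z) = z := Function.surjInv_eq (proj_surjective T S hTS)
  refine ⟨fun y => lift (r y) * σ₀ ((r y)⁻¹ * y), ?_, fun y => ?_⟩
  · refine Continuous.mul ?_ ?_
    · -- `y ↦ lift (r y)` factors through the discrete quotient `(G ⧸ S) ⧸ W`
      haveI : DiscreteTopology ((G ⧸ S) ⧸ W) := QuotientGroup.discreteTopology hWo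
      exact (continuous_of_discreteTopology
        (f := fun c : (G ⧸ S) ⧸ W => lift (Quotient.out c))).comp
        (QuotientGroup.continuous_mk (N := W))
    · exact hσ₀c.comp_continuous ((hrc.inv).mul continuous_id) hrW
  · change q (lift (r y) * σ₀ ((r y)⁻¹ * y)) = y
    rw [map_mul, hlift, hσ₀q _ (hrW y), mul_inv_cancel_left]

end Step

/-! ### Step 2: Zorn's lemma -/

section Zorn

variable (N : Subgroup G) [N.Normal]

/-- A **section modulo `S`**: a closed normal subgroup `S ≤ N` together with representatives
`f : G ⧸ N → G` of a continuous section `G ⧸ N → G ⧸ S` of the projection (`f c ∈ c` and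
`c ↦ f c mod S` continuous). [cite: Shatz1972, Ch. I §2 Thm. 3 (proof: the pairs ⟨S, λ⟩)] -/
structure SectionDatum where
  /-- the closed normal subgroup `S ≤ N` -/
  S : Subgroup G
  normal : S.Normal
  isClosed : IsClosed (S : Set G)
  le : S ≤ N
  /-- representatives of the section `G ⧸ N → G ⧸ S` -/
  f : G ⧸ N → G
  cont : Continuous fun c => (QuotientGroup.mk (f c) : G ⧸ S)
  sec : ∀ c, (QuotientGroup.mk (f c) : G ⧸ N) = c

namespace SectionDatum

variable {N}

-- projection instance on this file's own structure (the subgroup of a datum is normal)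
attribute [instance] SectionDatum.normal

/-- Refinement order: `D ≤ D'` iff `S' ≤ S` and the section of `D'` lifts that of `D`.
[folklore] -/
instance : Preorder (SectionDatum N) where
  le D D' := D'.S ≤ D.S ∧ ∀ c, (D'.f c)⁻¹ * D.f c ∈ D.S
  le_refl D := ⟨le_rfl, fun c => by simp [D.S.one_mem]⟩
  le_trans D D' D'' h h' := ⟨h'.1.trans h.1, fun c => by
    have := D.S.mul_mem (h.1 (h'.2 c)) (h.2 c)
    rwa [mul_assoc, mul_inv_cancel_left] at this⟩

omit [IsTopologicalGroup G] [N.Normal] in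
/-- Unfolding the order. [folklore] -/
theorem le_def (D D' : SectionDatum N) :
    D ≤ D' ↔ D'.S ≤ D.S ∧ ∀ c, (D'.f c)⁻¹ * D.f c ∈ D.S := Iff.rfl

/-- The trivial datum `S = N`. [folklore] -/
def top (hN : IsClosed (N : Set G)) : SectionDatum N where
  S := N
  normal := inferInstance
  isClosed := hN
  le := le_rfl
  f := Quotient.out
  cont := by
    have : (fun c : G ⧸ N => (QuotientGroup.mk (Quotient.out c) : G ⧸ N)) = id :=
      funext fun c => QuotientGroup.out_eq' c
    rw [this]
    exact continuous_id
  sec c := QuotientGroup.out_eq' c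

variable [CompactSpace G]

omit [N.Normal] in
/-- **Chains are bounded** (Shatz I §2, proof of Thm. 3): for a nonempty chain `(Sᵢ, fᵢ)` take
`S = ⋂ Sᵢ` and `f c ∈ ⋂ᵢ fᵢ(c) Sᵢ` (nonempty by compactness); continuity of `c ↦ f c mod S`
because `G ⧸ S → ∏ G ⧸ Sᵢ` is a closed embedding. [cite: Shatz1972, Ch. I §2 Thm. 3 (proof)] -/
theorem bddAbove_of_isChain (C : Set (SectionDatum N)) (hC : IsChain (· ≤ ·) C)
    (hne : C.Nonempty) : BddAbove C := by
  haveI : Nonempty C := hne.to_subtype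
  -- the intersection subgroup
  let S₀ : Subgroup G := ⨅ D : C, D.1.S
  haveI hS₀n : S₀.Normal := Subgroup.normal_iInf_normal fun D => D.1.normal
  have hS₀c : IsClosed (S₀ : Set G) := by
    rw [Subgroup.coe_iInf]
    exact isClosed_iInter fun D => D.1.isClosed
  have hS₀le : ∀ D : C, S₀ ≤ D.1.S := fun D => iInf_le _ D
  -- the cosets `fᵢ(c) Sᵢ` form a directed family of nonempty compact closed sets
  have hdir : ∀ c : G ⧸ N, Directed (· ⊇ ·) fun D : C => D.1.f c • (D.1.S : Set G) := by
    intro c D D'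
    rcases hC.total D.2 D'.2 with h | h
    · refine ⟨D', fun x hx => ?_, subset_rfl⟩
      rw [mem_leftCoset_iff] at hx ⊢
      have := D.1.S.mul_mem (D.1.S.inv_mem (h.2 c)) (h.1 hx)
      rwa [mul_inv_rev, inv_inv, mul_assoc, mul_inv_cancel_left] at this
    · refine ⟨D, subset_rfl, fun x hx => ?_⟩
      rw [mem_leftCoset_iff] at hx ⊢
      have := D'.1.S.mul_mem (D'.1.S.inv_mem (h.2 c)) (h.1 hx)
      rwa [mul_inv_rev, inv_inv, mul_assoc, mul_inv_cancel_left] at this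
  have hne' : ∀ c : G ⧸ N, (⋂ D : C, D.1.f c • (D.1.S : Set G)).Nonempty := fun c =>
    IsCompact.nonempty_iInter_of_directed_nonempty_isCompact_isClosed _ (hdir c)
      (fun D => ⟨D.1.f c, by rw [mem_leftCoset_iff, inv_mul_cancel]; exact D.1.S.one_mem⟩)
      (fun D => (D.1.isClosed.smul _).isCompact) fun D => D.1.isClosed.smul _
  choose f₀ hf₀ using hne'
  have hf₀' : ∀ (c) (D : C), (D.1.f c)⁻¹ * f₀ c ∈ D.1.S := fun c D =>
    (mem_leftCoset_iff _).1 (Set.mem_iInter.1 (hf₀ c) D)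
  -- the closed embedding `G ⧸ S₀ → ∏ G ⧸ Sᵢ`
  let Φ : G ⧸ S₀ → ∀ D : C, G ⧸ D.1.S := fun z D => proj S₀ D.1.S (hS₀le D) z
  have hΦc : Continuous Φ := continuous_pi fun D => continuous_proj _ _ _
  have hΦi : Function.Injective Φ := by
    rintro ⟨x⟩ ⟨y⟩ h
    change ((x : G) : G ⧸ S₀) = ((y : G) : G ⧸ S₀)
    rw [QuotientGroup.eq]
    refine Subgroup.mem_iInf.2 fun D => ?_
    rw [← QuotientGroup.eq]
    exact congr_fun h D
  haveI : ∀ D : C, T2Space (G ⧸ D.1.S) := fun D => by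
    haveI : IsClosed (D.1.S : Set G) := D.1.isClosed
    infer_instance
  have hΦ : Topology.IsClosedEmbedding Φ := hΦc.isClosedEmbedding hΦi
  refine ⟨⟨S₀, hS₀n, hS₀c, (hS₀le (Classical.arbitrary C)).trans (Classical.arbitrary C).1.le,
    f₀, ?_, fun c => ?_⟩, fun D hD => ⟨hS₀le ⟨D, hD⟩, fun c => ?_⟩⟩
  · rw [hΦ.isInducing.continuous_iff]
    refine continuous_pi fun D => ?_
    change Continuous fun c => proj S₀ D.1.S (hS₀le D) (QuotientGroup.mk (f₀ c))
    have heq : ∀ c, proj S₀ D.1.S (hS₀le D) (QuotientGroup.mk (f₀ c)) =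
        (QuotientGroup.mk (D.1.f c) : G ⧸ D.1.S) := fun c => by
      rw [proj_mk, QuotientGroup.eq, ← inv_mem_iff, mul_inv_rev, inv_inv]
      exact hf₀' c D
    exact D.1.cont.congr fun c => (heq c).symm
  · let D := Classical.arbitrary C
    refine Eq.trans ?_ (D.1.sec c)
    rw [QuotientGroup.eq, ← inv_mem_iff, mul_inv_rev, inv_inv]
    exact D.1.le (hf₀' c D)
  · rw [← inv_mem_iff, mul_inv_rev, inv_inv]
    exact hf₀' c ⟨D, hD⟩

variable [TotallyDisconnectedSpace G]

omit [N.Normal] in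
/-- **A maximal datum has `S = 1`** (Shatz I §2, proof of Thm. 3): otherwise an open normal
subgroup `U` with `S ⊄ U` exists (profiniteness), and `exists_section_of_inf_le` refines the
datum to `S ∩ U`. [cite: Shatz1972, Ch. I §2 Thm. 3 (proof)] -/
theorem eq_bot_of_isMax (D : SectionDatum N) (hD : IsMax D) : D.S = ⊥ := by
  by_contra hne
  obtain ⟨s, hs, hs1⟩ : ∃ s ∈ D.S, s ≠ 1 := by
    by_contra h
    push Not at h
    exact hne ((Subgroup.eq_bot_iff_forall _).2 h)
  -- an open normal subgroup missing `s`
  obtain ⟨U, hU⟩ := ProfiniteGrp.exist_openNormalSubgroup_sub_open_nhds_of_one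
    (isOpen_compl_singleton (x := s)) (by simpa using hs1.symm)
  have hsU : s ∉ (U : Subgroup G) := fun h => hU h rfl
  let T : Subgroup G := D.S ⊓ U
  haveI : T.Normal := Subgroup.normal_inf_normal D.S U
  have hTS : T ≤ D.S := inf_le_left
  obtain ⟨σ, hσc, hσ⟩ := exists_section_of_inf_le D.S T D.isClosed hTS U U.isOpen
    (fun x hx => ⟨hx.2, hx.1⟩)
  -- the refined datum
  let D' : SectionDatum N :=
    { S := T
      normal := inferInstance
      isClosed := D.isClosed.inter (U.toOpenSubgroup.isClosed)
      le := hTS.trans D.le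
      f := fun c => Quotient.out (σ (QuotientGroup.mk (D.f c)))
      cont := by
        have : (fun c => (QuotientGroup.mk (Quotient.out (σ (QuotientGroup.mk (D.f c)))) : G ⧸ T))
            = fun c => σ (QuotientGroup.mk (D.f c)) := funext fun c => QuotientGroup.out_eq' _
        rw [this]
        exact hσc.comp D.cont
      sec := fun c => by
        have h1 : (QuotientGroup.mk (Quotient.out (σ (QuotientGroup.mk (D.f c)))) : G ⧸ T) =
            σ (QuotientGroup.mk (D.f c)) := QuotientGroup.out_eq' _
        have h2 := congrArg (proj T D.S hTS) h1
        rw [hσ, proj_mk, QuotientGroup.eq] at h2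
        refine Eq.trans ?_ (D.sec c)
        rw [QuotientGroup.eq]
        exact D.le h2 }
  have hle : D ≤ D' := by
    refine ⟨hTS, fun c => ?_⟩
    have h1 : (QuotientGroup.mk (Quotient.out (σ (QuotientGroup.mk (D.f c)))) : G ⧸ T) =
        σ (QuotientGroup.mk (D.f c)) := QuotientGroup.out_eq' _
    have h2 := congrArg (proj T D.S hTS) h1
    rw [hσ, proj_mk, QuotientGroup.eq] at h2
    exact h2
  have := (hD hle).1
  exact hsU ((this hs).2)

end SectionDatum

end Zorn

end ProfiniteCrossSection

open ProfiniteCrossSection in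
/-- **Cross-section theorem** (Shatz I §2 Thm. 3; Serre I §1.2 Prop. 1): for a profinite group
`G` (compact, Hausdorff, totally disconnected) and a closed normal subgroup `N`, the projection
`G → G ⧸ N` admits a continuous section. [cite: Shatz1972, Ch. I §2 Thm. 3 (Cross-section Theorem)]
[cite: SerreGaloisCohomology1997, I §1.2 Prop. 1] -/
theorem exists_continuous_section_of_isClosed {G : Type u} [Group G] [TopologicalSpace G]
    [IsTopologicalGroup G] [CompactSpace G] [T2Space G] [TotallyDisconnectedSpace G]
    (N : Subgroup G) [N.Normal] (hN : IsClosed (N : Set G)) :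
    ∃ s : G ⧸ N → G, Continuous s ∧ ∀ c, (QuotientGroup.mk (s c) : G ⧸ N) = c := by
  haveI : Nonempty (SectionDatum N) := ⟨SectionDatum.top hN⟩
  obtain ⟨D, hD⟩ := zorn_le_nonempty (α := SectionDatum N)
    fun C hC hne => SectionDatum.bddAbove_of_isChain C hC hne
  have hbot := SectionDatum.eq_bot_of_isMax D hD
  -- `G → G ⧸ D.S` is a homeomorphism since `D.S = ⊥`
  have hinj : Function.Injective (QuotientGroup.mk : G → G ⧸ D.S) := fun x y h => by
    rw [QuotientGroup.eq, hbot, Subgroup.mem_bot, inv_mul_eq_one] at h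
    exact h
  let e : G ≃ₜ G ⧸ D.S :=
    (Equiv.ofBijective _ ⟨hinj, QuotientGroup.mk_surjective⟩).toHomeomorphOfContinuousOpen
      QuotientGroup.continuous_mk (QuotientGroup.isOpenMap_coe)
  refine ⟨D.f, ?_, D.sec⟩
  have : D.f = e.symm ∘ fun c => (QuotientGroup.mk (D.f c) : G ⧸ D.S) := by
    funext c
    exact (e.symm_apply_apply (D.f c)).symm
  rw [this]
  exact e.symm.continuous.comp D.cont

/-- The cross-section theorem with the membership it is used through: a continuous
`s : G ⧸ N → G` with `s(c) ∈ c`, so that `(s x̄)⁻¹ x ∈ N` for every `x : G` (the continuous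
"`N`-coordinate" of `x`). [cite: Shatz1972, Ch. I §2 Thm. 3 (Cross-section Theorem)] -/
theorem exists_continuous_section_mem {G : Type u} [Group G] [TopologicalSpace G]
    [IsTopologicalGroup G] [CompactSpace G] [T2Space G] [TotallyDisconnectedSpace G]
    (N : Subgroup G) [N.Normal] (hN : IsClosed (N : Set G)) :
    ∃ s : G ⧸ N → G, Continuous s ∧ (∀ c, (QuotientGroup.mk (s c) : G ⧸ N) = c) ∧
      ∀ x : G, (s (x : G ⧸ N))⁻¹ * x ∈ N := by
  obtain ⟨s, hs, hsec⟩ := exists_continuous_section_of_isClosed N hN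
  exact ⟨s, hs, hsec, fun x => QuotientGroup.eq.1 (hsec x)⟩

end Literature.NumberTheory.GaloisRepresentations

end
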